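import Literature.AnabelianGeometry.AbsoluteAnabelian.LocalClassFieldTheoryForms
import Literature.NumberTheory.GaloisRepresentations.LocalCorInjective
import HarnessLib

/-!
# LCFT forms of [AbsAnab] §1.2 / [FrdII] §2 / [AbsTopIII] §1 — discharges (proof-only companion)

Proof-only companion of `LocalClassFieldTheoryForms.lean` (abc-iut layer L4, typer abc-iut-L4-t4,
p404656; node `LCFT:Facts` of the abc-iut DAG, FOUNDATIONS row 15).  That file packages local
class field theory in the exact shapes Mochizuki invokes, as NAMED FACTS; this file discharges the
ones the tree's continuous-cohomology library already proves.

* `mlf_H2_mu_equiv_zmod_holds : mlf_H2_mu_equiv_zmod` — form L3, [FrdII] Def 2.2 (ii) p. 18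
  ("`H²(H, μ_N(A)) ≅ ℤ/Nℤ` [NSW Thm 7.2.6]"), [AbsAnab] Prop 1.2.1 (vii) p. 11 / [AbsTopIII]
  Cor 1.10 (i)(a) p. 42 at finite level: for a non-archimedean local field `K` of characteristic
  `0` and `n ≥ 1`, `H²(G_K, μ_n) ≅ ℤ/nℤ`.  Proof: the tree proves `|H²(Gal(K̄/E), μ_n)| = n`
  and cyclicity for every finite `E/K` inside `K̄`
  (`Literature.NumberTheory.GaloisRepresentations.natCard_two_mu_eq`, `isAddCyclic_two_mu`:
  Kummer theory + the Brauer class of exact order `n`, Serre, *Local Fields* XIII §3); take `E = K`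
  (`galFixing_bot`, `resHEquivOfTop`) and the cyclic-group isomorphism `zmodAddCyclicAddEquiv`.

Not discharged here (left as named facts): `mlf_reciprocity_completion` (L1, `(K^×)^∧ ≅ G_K^{ab}`),
`mlf_H1_mu_equiv_abelianization_mod` (L5), `galoisMLF_iso_unitImage` ([AbsAnab] Prop 1.2.1 (iii)).
No new definitions; nothing here concerns [IUTchIII].
-/

noncomputable section

universe u

namespace Literature.AnabelianGeometry.AbsoluteAnabelian

open Field IntermediateField
open Literature.NumberTheory.GaloisRepresentations
open Literature.NumberTheory.GaloisRepresentations.DiscreteGaloisModule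
open Literature.NumberTheory.GaloisRepresentations.LocalWeilDatum

/-- **`H²(G_K, μ_n) ≅ ℤ/nℤ` for a non-archimedean local field `K` of characteristic `0`**
(discharge of the named fact `mlf_H2_mu_equiv_zmod`, [FrdII] Def 2.2 (ii) p. 18 "`≅ H²(H, μ_N(A))
≅ ℤ/Nℤ` [cf. [NSW], Chapter 7, Theorem 7.2.6]"): the tree's `natCard_two_mu_eq` /
`isAddCyclic_two_mu` (order `n`, cyclic) at `E = K`, transported along `resHEquivOfTop`.
[cite: MochizukiFrdII2008, Def 2.2 (ii) p.18] -/
theorem mlf_H2_mu_equiv_zmod_holds : mlf_H2_mu_equiv_zmod.{u} := by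
  intro K _ _ _ _ _ n _
  have hbot : ∀ g : absoluteGaloisGroup K,
      g ∈ galFixing K (⊥ : IntermediateField K (AlgebraicClosure K)) := fun g => by
    rw [galFixing_bot]; trivial
  let eT := resHEquivOfTop (mu K n)
    (galFixing K (⊥ : IntermediateField K (AlgebraicClosure K))) hbot 2
  have hB : Nat.card (continuousCohomology 2 (mu K n).toTopRep) = n :=
    (Nat.card_congr eT.toEquiv).trans (natCard_two_mu_eq K ⊥ n)
  haveI := isAddCyclic_two_mu K (⊥ : IntermediateField K (AlgebraicClosure K)) n
  have hBc : IsAddCyclic (continuousCohomology 2 (mu K n).toTopRep) :=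
    isAddCyclic_of_injective eT.toAddMonoidHom eT.injective
  exact ⟨(zmodAddCyclicAddEquiv hBc).symm.trans (ZMod.ringEquivCongr hB).toAddEquiv⟩

end Literature.AnabelianGeometry.AbsoluteAnabelian
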